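import Literature.NumberTheory.GelbartRogawski1991.DoubledWeilRepresentationDetTwist
import Literature.NumberTheory.Automorphic.UnitaryGroupAdelicOneTorusDictionary
import Literature.NumberTheory.Automorphic.UnitaryLineArchExponents
import Literature.NumberTheory.Automorphic.IdeleClassCharacterConjugate
import Literature.NumberTheory.Automorphic.ConjugateSelfDualCharacters
import Literature.RepresentationTheory.HarrisKudlaSweet1996.SplittingCharactersCM
import HarnessLib

/-!
# The archimedean type of the ratio character `α̃ : d ↦ α(d / d̄)` of an automorphic character `α` of `U(1)(𝔸_{L⁺})`
# (Gelbart–Rogawski 1991 §3.1 Remark p. 457: `s* = s ⊗ ν'`, read at the archimedean places)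

Topic `NumberTheory/Automorphic`; namespace `Literature.NumberTheory.Automorphic.UnitaryGroup.AdelicCharactersArchType`
(sequel of `UnitaryGroupAdelicCharactersDet` / `…DetPair`, item (A) of the COR-CM X3-Char analysis; this file and its sequel
`UnitaryGroupAdelicCharactersArchTypeTwist` are the GENERIC half of item (E), the archimedean type).  KERNEL ONLY: proved
theorems and three junction definitions with bodies (`relNormOneChar`, `quotChar`, `lineCharOf`; `archRatio`); 0 records,
0 named facts, 0 `sorry`.

For a CM field `L` (maximal totally real subfield `L⁺`, complex conjugation `c`) and a character
`α : U(1)(𝔸_{L⁺}) → ℂˣ` of the adelic norm-one torus in the unitary-group currency `UnitaryGroup.adelicOne L⁺ L c`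
(`UnitaryGroupAdelicCenter`) which is CONTINUOUS and AUTOMORPHIC (trivial on the principal norm-one ideles) — exactly the
hypotheses `hα`, `hαrat` of the tree's ratio Hecke character
`GRConstruction.DoubledWeilDetTwist.ratioHecke L α hα hαrat : d ↦ α (d / d̄)` ([GelbartRogawski1991, §3.1 Remark p. 457
L4–13]: «`s* = s ⊗ ν'`, `ν'` an automorphic character of `E¹` regarded as a character of `G` via `det`»; the Hecke character of
the twisted splitting is `χ · ν̃'`) — this file computes the ARCHIMEDEAN TYPE of `α̃ = ratioHecke α`:

* § 1 **junction** of the pin currency with the arch-type currency of the tree: `α` IS a continuous unitary character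
  `lineCharOf α` of the automorphic quotient `[U(1)] = relNormOneIdeles L⁺ L ⧸ relNormOneRat L⁺ L` (`UnitaryLineCharacters`;
  unitarity by [Godement1964, §5 Thm. 4] = GR-2's `cm_norm_apply_eq_one_of_trivial_on_principal`), so that the
  classification `UnitaryLineChar.archType` / `existsUnique_hasArchType` ([BrockerTomDieck1985, II 8.1], file
  `UnitaryLineArchExponents`) applies to `α`: `α_∞ (u_w)_w = ∏_w u_w^{m_w}` for a unique `m = archType (lineCharOf α)`;
* § 2 the **archimedean ratio** `archRatio x = x / x̄ ∈ U(1)(L⁺ ⊗ ℝ)` of `x ∈ L_∞ˣ`, with `idelesRatio (x, 1) = (x / x̄, 1)`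
  and place coordinates `ι_w((x/x̄)_w) = (ι_w x_w / |ι_w x_w|)²`, whence `archWeight m (x / x̄) = ∏_w (ι_w x_w/|ι_w x_w|)^{2 m_w}`;
* § 3 **`hasUnitaryArchType_ratioHecke_iff`**: `α̃` has unitary archimedean type `(2m, 0)` (the tree's
  `HeckeCharacter.HasUnitaryArchType`, [Patrikis2019, §2.1]) **iff** `α` has archimedean type `m`; unconditionally
  `α̃` has type `(2 · archType (lineCharOf α), 0)` (`hasUnitaryArchType_ratioHecke`).  (`⇐` is the computation of § 2; `⇒` is
  uniqueness of ∞-types at the complex places of `L`, `IdeleClassGroup.hasInfinityType_unique`.)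

The twisted splitting character `χ₀ · α̃` (∞-type `e₀ + 2m`, weight one, CM type) is the sequel
`UnitaryGroupAdelicCharactersArchTypeTwist`.  Nothing of GR-2's dictionary `UnitaryGroupAdelicOneTorusDictionary`, of
`UnitaryLineCharacters` / `UnitaryLineArchExponents`, of `ConjugateSelfDual*` or of `Arthur2013/Leaves/TorusDictionary`
(`hasUnitaryArchType_pullback_iff`, the same dictionary in the `TorusDict` currency with the opposite sign convention) is
restated: all are imported by name.  Use (COR-CM cell, X3-Char residual (E), `pinning/pin-3/X3-TREE-SOCKET.md` ADDENDUM v7):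
at an index line of the pin the splitting is `chiSplittingLine (χ₀ · ratioHecke α_i)`; the `Thm418Rest` fields `μ`,
`isConjugateSymplectic`, `hasWeight_one` and the CM type `Φ_μ` at that line are read off `χ₀ · α̃_i` by the sequel.
HC_CM is NOT proved here or anywhere in the tree.

References: S. Gelbart, J. Rogawski, *L-functions and Fourier–Jacobi coefficients for the unitary group U(3)*, Invent.
Math. 105 (1991), §3.1 Remark p. 457 [GelbartRogawski1991]; R. Godement, *Domaines fondamentaux des groupes arithmétiques*,
Sém. Bourbaki 257 (1962/63), §5 Thm. 4 [Godement1964]; T. Bröcker, T. tom Dieck, *Representations of Compact Lie Groups*,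
GTM 98 (1985), II (8.1) [BrockerTomDieck1985]; S. Patrikis, *Variations on a theorem of Tate*, Mem. AMS 258 (2019), §2.1
[Patrikis2019]; V. Platonov, A. Rapinchuk, *Algebraic Groups and Number Theory* (1994), §6.2 [PlatonovRapinchuk1994].
Provenance: pub-hodgecm2 cell, seat item6-p3 (gen 11).
-/

set_option autoImplicit false

noncomputable section

open NumberField NumberField.InfinitePlace
open Literature.NumberTheory.GaloisRepresentations
open Literature.NumberTheory.GelbartRogawski1991.GRConstruction
open Literature.RepresentationTheory.HarrisKudlaSweet1996

namespace Literature.NumberTheory.Automorphic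

namespace UnitaryGroup

namespace AdelicCharactersArchType

variable (L : Type) [Field L] [NumberField L] [IsCMField L]


variable (α : adelicOne (maximalRealSubfield L) L (IsCMField.complexConj L) →* ℂˣ) (hα : Continuous α)
  (hαrat : ∀ u : adelicOne (maximalRealSubfield L) L (IsCMField.complexConj L), (u : ideleGroup L) ∈ principalIdeles L → α u = 1)

/-! ## §1. Junction: the pin's character `α` of `U(1)(𝔸_{L⁺})` as a unitary character of `[U(1)]` -/

/-- `α` read on the relative-norm-one torus `ker N_{L/L⁺} = relNormOneIdeles L⁺ L` (GR-2's identification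
`cmAdelicOneEquivRelNormOne`, the identity on ideles). [cite: PlatonovRapinchuk1994, §6.2] -/
def relNormOneChar : relNormOneIdeles (maximalRealSubfield L) L →* ℂˣ :=
  α.comp (cmAdelicOneEquivRelNormOne L).symm.toMonoidHom

/-- formula. [cite: PlatonovRapinchuk1994, §6.2] -/
@[simp] theorem relNormOneChar_apply (a : relNormOneIdeles (maximalRealSubfield L) L) :
    relNormOneChar L α a = α ((cmAdelicOneEquivRelNormOne L).symm a) := rfl

include hαrat in
/-- `α` (automorphic) kills the rational points `L¹ = relNormOneRat`. [cite: PlatonovRapinchuk1994, §6.2] -/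
theorem relNormOneRat_le_ker : relNormOneRat (maximalRealSubfield L) L ≤ (relNormOneChar L α).ker := by
  intro a ha
  rw [MonoidHom.mem_ker, relNormOneChar_apply]
  exact hαrat _ ((mem_relNormOneRat_iff (maximalRealSubfield L) L a).1 ha)

include hα hαrat in
/-- `α` descended to the automorphic quotient `[U(1)] = L¹ \ U(1)(𝔸_{L⁺})`, `ℂˣ`-valued and continuous. [cite: PlatonovRapinchuk1994, §6.2] -/
def quotChar : (relNormOneIdeles (maximalRealSubfield L) L ⧸ relNormOneRat (maximalRealSubfield L) L) →ₜ* ℂˣ where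
  toMonoidHom := QuotientGroup.lift (relNormOneRat (maximalRealSubfield L) L) (relNormOneChar L α) (relNormOneRat_le_ker L α hαrat)
  continuous_toFun := by
    change Continuous (QuotientGroup.lift (relNormOneRat (maximalRealSubfield L) L) (relNormOneChar L α) (relNormOneRat_le_ker L α hαrat))
    rw [(QuotientGroup.isQuotientMap_mk (relNormOneRat (maximalRealSubfield L) L)).continuous_iff]
    exact hα.comp (continuous_adelicOneEquivRelNormOne_symm _ L _ _ _)

/-- formula on classes. [cite: PlatonovRapinchuk1994, §6.2] -/
@[simp] theorem quotChar_mk (a : relNormOneIdeles (maximalRealSubfield L) L) :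
    quotChar L α hα hαrat (QuotientGroup.mk a) = α ((cmAdelicOneEquivRelNormOne L).symm a) := rfl

/-- **The unitary line character of `α`**: `α` as a continuous character of `[U(1)]` with values in the unit
circle (unitarity: GR-2's `cm_norm_apply_eq_one_of_trivial_on_principal`, [Godement1964, §5 Thm. 4]). [cite: Godement1964, §5 Thm. 4] -/
def lineCharOf : ContinuousMonoidHom (relNormOneIdeles (maximalRealSubfield L) L ⧸ relNormOneRat (maximalRealSubfield L) L) Circle :=
  unitaryToCircle (quotChar L α hα hαrat) fun g => by
    induction g using QuotientGroup.induction_on with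
    | H a => rw [quotChar_mk]; exact cm_norm_apply_eq_one_of_trivial_on_principal L α hα hαrat _

/-- values on classes, in `ℂ`. [cite: Godement1964, §5 Thm. 4] -/
@[simp] theorem coe_lineCharOf_mk (a : relNormOneIdeles (maximalRealSubfield L) L) :
    ((lineCharOf L α hα hαrat (QuotientGroup.mk a) : Circle) : ℂ) = α ((cmAdelicOneEquivRelNormOne L).symm a) := rfl

/-- values on the image of `u ∈ U(1)(𝔸_{L⁺})`: `lineCharOf α [u] = α u`. [cite: Godement1964, §5 Thm. 4] -/
theorem coe_lineCharOf_mk_cmAdelicOneEquivRelNormOne (u : adelicOne (maximalRealSubfield L) L (IsCMField.complexConj L)) :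
    ((lineCharOf L α hα hαrat (QuotientGroup.mk (cmAdelicOneEquivRelNormOne L u)) : Circle) : ℂ) = α u := by
  rw [coe_lineCharOf_mk, MulEquiv.symm_apply_apply]

/-- values on the archimedean torus `U(1)(L⁺ ⊗ ℝ)`: `lineCharOf α (cl y) = α ((y, 1))`. [cite: BorelJacquet1979, §4.1] -/
theorem coe_lineCharOf_relNormOneInfToQuot (y : relNormOneInfUnits (maximalRealSubfield L) L) :
    ((lineCharOf L α hα hαrat (relNormOneInfToQuot (maximalRealSubfield L) L y) : Circle) : ℂ) =
      α ((cmAdelicOneEquivRelNormOne L).symm (relNormOneInfToIdeles (maximalRealSubfield L) L y)) := rfl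


/-- **the archimedean type of `α` in the pin's currency** (interface asked by the COR-CM pin): `lineCharOf α` has archimedean
type `m` iff `α (t, 1) = ∏_w ι_w(t_w)^{m_w}` for every `t ∈ U(1)(L⁺ ⊗ ℝ)`, the archimedean unit `(t, 1)` being read in
`U(1)(𝔸_{L⁺})` through GR-2's identification. [cite: BrockerTomDieck1985, Ch. II Prop. 8.1] -/
theorem hasArchType_lineCharOf_iff (m : InfinitePlace L → ℤ) :
    UnitaryLineChar.HasArchType L (lineCharOf L α hα hαrat) m ↔
      ∀ t : relNormOneInfUnits (maximalRealSubfield L) L,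
        ((α ((cmAdelicOneEquivRelNormOne L).symm (relNormOneInfToIdeles (maximalRealSubfield L) L t)) : ℂˣ) : ℂ) =
          archWeight L m t :=
  UnitaryLineChar.hasArchType_iff L _ m

/-- **archimedean type `0` = `α` trivial on the archimedean torus**: `lineCharOf α` has type `0` iff `α (t, 1) = 1` for every
`t ∈ U(1)(L⁺ ⊗ ℝ)`. [cite: BrockerTomDieck1985, Ch. II Prop. 8.1] -/
theorem hasArchType_lineCharOf_zero_iff :
    UnitaryLineChar.HasArchType L (lineCharOf L α hα hαrat) 0 ↔
      ∀ t : relNormOneInfUnits (maximalRealSubfield L) L,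
        α ((cmAdelicOneEquivRelNormOne L).symm (relNormOneInfToIdeles (maximalRealSubfield L) L t)) = 1 := by
  rw [hasArchType_lineCharOf_iff]
  refine forall_congr' fun t => ?_
  rw [archWeight_zero, ← Units.val_one, Units.val_inj]

/-- the archimedean type of `α` as DATA in the pin's currency: `α (t, 1) = archWeight (archType (lineCharOf α)) t`.
[cite: BrockerTomDieck1985, Ch. II Def. 8.2] -/
theorem coe_apply_archUnit_eq_archWeight_archType (t : relNormOneInfUnits (maximalRealSubfield L) L) :
    ((α ((cmAdelicOneEquivRelNormOne L).symm (relNormOneInfToIdeles (maximalRealSubfield L) L t)) : ℂˣ) : ℂ) =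
      archWeight L (UnitaryLineChar.archType L (lineCharOf L α hα hαrat)) t :=
  (hasArchType_lineCharOf_iff L α hα hαrat _).1 (UnitaryLineChar.hasArchType_archType L _) t

/-! ## §2. The archimedean ratio `x / x̄ ∈ U(1)(L⁺ ⊗ ℝ)` of `x ∈ L_∞ˣ` and its place coordinates -/

/-- `(x / x̄, 1) = (x, 1) / (x, 1)‾` is the GR91 ratio idele `idelesRatio (x, 1)`, as ideles. [cite: GelbartRogawski1991, §3.1 Remark p. 457 L4–13] -/
theorem infiniteIdeles_div_complexConj_smul (x : (InfiniteAdeleRing L)ˣ) :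
    infiniteIdeles L (x / IsCMField.complexConj L • x) =
      ((DoubledWeilDetTwist.idelesRatio L (infiniteIdeles L x) :
        adelicOne (↥(maximalRealSubfield L)) L (IsCMField.complexConj L)) : ideleGroup L) := by
  rw [DoubledWeilDetTwist.coe_idelesRatio, DoubledWeilDetTwist.conjIdele_eq_smul, galSmul_infiniteIdeles, map_div]

/-- for an archimedean unit `x ∈ L_∞ˣ` of the CM field `L`, the ratio `x / x̄` lies in the archimedean torus
`U(1)(L⁺ ⊗ ℝ) = relNormOneInfUnits L⁺ L`. [cite: GelbartRogawski1991, §3.1 Remark p. 457 L4–13] -/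
theorem div_complexConj_smul_mem_relNormOneInfUnits (x : (InfiniteAdeleRing L)ˣ) :
    x / IsCMField.complexConj L • x ∈ relNormOneInfUnits (↥(maximalRealSubfield L)) L := by
  have hmem : infiniteIdeles L (x / IsCMField.complexConj L • x) ∈ relNormOneIdeles (↥(maximalRealSubfield L)) L := by
    rw [← cm_adelicOne_eq_relNormOneIdeles L, infiniteIdeles_div_complexConj_smul]
    exact (DoubledWeilDetTwist.idelesRatio L (infiniteIdeles L x)).2
  rw [mem_relNormOneInfUnits_iff]
  apply infiniteIdeles_injective
  rw [infiniteIdeles_infIdeleGalNorm, map_one]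
  exact (mem_relNormOneIdeles_iff _ _ _).1 hmem

/-- **the archimedean ratio** `archRatio x := x / x̄ ∈ U(1)(L⁺ ⊗ ℝ)` of `x ∈ L_∞ˣ` (archimedean Hilbert-90 map). [cite: GelbartRogawski1991, §3.1 Remark p. 457 L4–13] -/
def archRatio (x : (InfiniteAdeleRing L)ˣ) : relNormOneInfUnits (↥(maximalRealSubfield L)) L :=
  ⟨x / IsCMField.complexConj L • x, div_complexConj_smul_mem_relNormOneInfUnits L x⟩

/-- underlying unit. [cite: GelbartRogawski1991, §3.1 Remark p. 457 L4–13] -/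
@[simp] theorem coe_archRatio (x : (InfiniteAdeleRing L)ˣ) :
    ((archRatio L x : relNormOneInfUnits (↥(maximalRealSubfield L)) L) : (InfiniteAdeleRing L)ˣ) =
      x / IsCMField.complexConj L • x := rfl

/-- `archRatio` is a homomorphism `L_∞ˣ →* U(1)(L⁺ ⊗ ℝ)`. [cite: GelbartRogawski1991, §3.1 Remark p. 457 L4–13] -/
theorem archRatio_mul (x y : (InfiniteAdeleRing L)ˣ) : archRatio L (x * y) = archRatio L x * archRatio L y := by
  apply Subtype.ext
  simp only [coe_archRatio, Subgroup.coe_mul, smul_mul', mul_div_mul_comm]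

/-- the GR91 ratio idele of `(x, 1)` IS `(archRatio x, 1)` read in `U(1)(𝔸_{L⁺})` (both are `(x / x̄, 1)`). [cite: GelbartRogawski1991, §3.1 Remark p. 457 L4–13] -/
theorem idelesRatio_infiniteIdeles (x : (InfiniteAdeleRing L)ˣ) :
    DoubledWeilDetTwist.idelesRatio L (infiniteIdeles L x) =
      (cmAdelicOneEquivRelNormOne L).symm (relNormOneInfToIdeles (↥(maximalRealSubfield L)) L (archRatio L x)) := by
  apply Subtype.ext
  rw [← infiniteIdeles_div_complexConj_smul]
  rfl

/-- **place coordinates of the ratio**: `ι_w((x/x̄)_w) = ι_w(x_w) / conj (ι_w(x_w)) = (ι_w x_w / |ι_w x_w|)²`. [cite: Patrikis2019, §2.1] -/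
theorem coe_archPlaceChar_archRatio (x : (InfiniteAdeleRing L)ˣ) (w : InfinitePlace L) :
    ((archPlaceChar L w (archRatio L x) : Circle) : ℂ) =
      (Completion.extensionEmbedding w ((x : InfiniteAdeleRing L) w) / (‖Completion.extensionEmbedding w ((x : InfiniteAdeleRing L) w)‖ : ℂ)) ^ 2 := by
  have hx0 : Completion.extensionEmbedding w ((x : InfiniteAdeleRing L) w) ≠ 0 := by
    rw [map_ne_zero]
    exact GaloisRepresentations.InfiniteIdele.coe_apply_ne_zero x w
  rw [HeckeCharacter.CMQuadraticExtension.div_norm_sq_eq_div_conj hx0, coe_archPlaceChar, coe_archRatio,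
    ← InfiniteAdeleRing.coe_infLocalUnits, ← InfiniteAdeleRing.coe_infLocalUnits, map_div, Units.val_div_eq_div_val,
    IdeleClassGroup.coe_infLocalUnits_complexConj_smul]

/-- **the typed weight of the ratio**: `archWeight m (x / x̄) = ∏_w (ι_w x_w / |ι_w x_w|)^{2 m_w}` — the unitary
archimedean value of type `(2m, 0)` at `x`. [cite: Patrikis2019, §2.1] -/
theorem archWeight_archRatio (m : InfinitePlace L → ℤ) (x : (InfiniteAdeleRing L)ˣ) :
    archWeight L m (archRatio L x) =
      ∏ w : InfinitePlace L, archUnitaryValue (2 * m w) 0 (Completion.extensionEmbedding w ((x : InfiniteAdeleRing L) w)) := by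
  rw [archWeight_eq_prod]
  refine Finset.prod_congr rfl fun w _ => ?_
  rw [coe_archPlaceChar_archRatio, HeckeCharacter.CMQuadraticExtension.archUnitaryValue_zero_right, zpow_mul, zpow_ofNat]

/-! ## §3. The archimedean type of `α̃ = ratioHecke α`: type `(2m, 0)` iff `α` has archimedean type `m` -/

/-- `α̃ ((x, 1)) = α (x / x̄, 1) = lineCharOf α (cl (archRatio x))`. [cite: GelbartRogawski1991, §3.1 Remark p. 457 L4–13] -/
theorem coe_ratioHecke_infiniteIdeles (x : (InfiniteAdeleRing L)ˣ) :
    ((DoubledWeilDetTwist.ratioHecke L α hα hαrat (infiniteIdeles L x) : ℂˣ) : ℂ) =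
      ((lineCharOf L α hα hαrat (relNormOneInfToQuot (↥(maximalRealSubfield L)) L (archRatio L x)) : Circle) : ℂ) := by
  rw [DoubledWeilDetTwist.ratioHecke_apply, idelesRatio_infiniteIdeles, coe_lineCharOf_relNormOneInfToQuot]

/-- **`⇐`: if `α` has archimedean type `m` then `α̃` has unitary archimedean type `(2m, 0)`** —
`α̃_w(z) = α_w(z/z̄) = (z/z̄)^{m_w} = (z/|z|)^{2 m_w}`. [cite: GelbartRogawski1991, §3.1 Remark p. 457 L4–13] -/
theorem hasUnitaryArchType_ratioHecke_of_hasArchType {m : InfinitePlace L → ℤ}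
    (hm : UnitaryLineChar.HasArchType L (lineCharOf L α hα hαrat) m) :
    (DoubledWeilDetTwist.ratioHecke L α hα hαrat).HasUnitaryArchType (fun w => 2 * m w) fun _ => 0 := by
  intro x
  rw [coe_ratioHecke_infiniteIdeles, (UnitaryLineChar.hasArchType_iff L _ m).1 hm, archWeight_archRatio]

/-- **the archimedean type of `α̃`, unconditionally**: `α̃` has unitary archimedean type `(2 · archType α, 0)`, where
`archType α := UnitaryLineChar.archType L (lineCharOf α)` is the (unique, Bröcker–tom Dieck II 8.1) archimedean type
of the automorphic character `α` of `[U(1)]`. [cite: GelbartRogawski1991, §3.1 Remark p. 457 L4–13] -/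
theorem hasUnitaryArchType_ratioHecke :
    (DoubledWeilDetTwist.ratioHecke L α hα hαrat).HasUnitaryArchType
      (fun w => 2 * UnitaryLineChar.archType L (lineCharOf L α hα hαrat) w) fun _ => 0 :=
  hasUnitaryArchType_ratioHecke_of_hasArchType L α hα hαrat (UnitaryLineChar.hasArchType_archType L _)


include hα hαrat in
/-- `α̃` is a unitary Hecke character (`α` is unitary, [Godement1964, §5 Thm. 4] via GR-2). [cite: Godement1964, §5 Thm. 4] -/
theorem isUnitary_ratioHecke : (DoubledWeilDetTwist.ratioHecke L α hα hαrat).IsUnitary := fun d => by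
  rw [DoubledWeilDetTwist.ratioHecke_apply]
  exact cm_norm_apply_eq_one_of_trivial_on_principal L α hα hαrat _

/-- **`⇒`: the type of `α̃` determines the type of `α`** — if `α̃` has unitary archimedean type `(2m, 0)` then `α` has
archimedean type `m` (uniqueness of ∞-types at the complex places of the CM field `L`). [cite: GelbartRogawski1991, §3.1 Remark p. 457 L4–13] -/
theorem hasArchType_of_hasUnitaryArchType_ratioHecke {m : InfinitePlace L → ℤ}
    (h : (DoubledWeilDetTwist.ratioHecke L α hα hαrat).HasUnitaryArchType (fun w => 2 * m w) fun _ => 0) :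
    UnitaryLineChar.HasArchType L (lineCharOf L α hα hαrat) m := by
  have hu := isUnitary_ratioHecke L α hα hαrat
  have e1 := (hasUnitaryArchType_iff_hasInfinityType_unitaryClassChar L _ hu _).1 h
  have e2 := (hasUnitaryArchType_iff_hasInfinityType_unitaryClassChar L _ hu _).1
    (hasUnitaryArchType_ratioHecke L α hα hαrat)
  have h12 := IdeleClassGroup.hasInfinityType_unique e1 e2
  have hm : m = UnitaryLineChar.archType L (lineCharOf L α hα hαrat) := by
    funext w
    have hw := congrFun h12 w
    omega
  rw [hm]
  exact UnitaryLineChar.hasArchType_archType L _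

/-- **The dictionary of archimedean types** ([GelbartRogawski1991, §3.1 Remark p. 457]: `s* = s ⊗ ν'` changes the Hecke
character `χ` of the splitting by `α̃`, `α = ν'`): `α̃ = ratioHecke α` has unitary archimedean type `(2m, 0)` if and only if
the automorphic character `α` of `U(1)(𝔸_{L⁺})` has archimedean type `m` on `U(1)(L⁺ ⊗ ℝ) = ∏_w U(1)`, i.e.
`α_∞ (u_w)_w = ∏_w u_w^{m_w}`. [cite: GelbartRogawski1991, §3.1 Remark p. 457 L4–13] -/
theorem hasUnitaryArchType_ratioHecke_iff (m : InfinitePlace L → ℤ) :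
    (DoubledWeilDetTwist.ratioHecke L α hα hαrat).HasUnitaryArchType (fun w => 2 * m w) (fun _ => 0) ↔
      UnitaryLineChar.HasArchType L (lineCharOf L α hα hαrat) m :=
  ⟨hasArchType_of_hasUnitaryArchType_ratioHecke L α hα hαrat, hasUnitaryArchType_ratioHecke_of_hasArchType L α hα hαrat⟩

end AdelicCharactersArchType

end UnitaryGroup

end Literature.NumberTheory.Automorphic

end
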